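/-
Copyright (c) 2026. All rights reserved.
Released under Apache 2.0 license as described in the file LICENSE.
-/
import Summits.HubbardSuperconductivity.HubbardLadder.Bounds.FugacityCentringWindow
import HarnessLib

/-!
# Adjacent-ratio window: the walk input from a ratio envelope (bounds.tex §13, Lemma 13.5)

HONEST FRAMING: ladder R1–R4 with certified numbers; no claim on H/H₀. These are bounds for
MODEL CLASSES (the typed repulsive/attractive Hubbard torus with a flux twist), no materials
claim. This file is MODEL-FREE: it is the abstract "walk" step of the canonical N-sector
device of bounds.tex Theorem 13 (N-sector form), stated for an arbitrary positive weight
sequence `w : ℕ → ℝ` on `{0, …, n}` tilted by `e^{sk}` (the objects `gcSum`, `gcMean`, `gcVar`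
of `FugacityCentringWindow`).

## What is proved

Write `p k = e^{sk} w k`, `m = gcMean w n s`, `Var = gcVar w n s`. Suppose the RATIO ENVELOPE
`A⁻ k · p k ≤ p (k+1)` (`k + 1 ≤ n`) and `p (k+1) ≤ A⁺ k · p k` (`k_L ≤ k`, `k + 1 ≤ n`) with
`A⁻ > 0` and `A⁺` antitone (for the Hubbard sector weights
`A∓ k = e^{s} (2|Λ| - k)/(k + 1 ± 2|Λ| r)`, `r` the imaginary-time dressing radius of an
annihilation operator — a successor part), and the Chebyshev input `Var ≤ K² / 4`.

* `not_monotone_run_right` / `not_antitone_run_left`: a positive sequence carrying `3/4` of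
  its tilted mass on the window `|k - m| ≤ K` cannot be non-decreasing on `[0, k_R + 1]` when
  `k_R ≥ m + 2K + 1`, nor non-increasing on `[k_L, n]` when `k_L + 2K + 1 ≤ m`.
* `envelope_right_le_one` / `one_le_envelope_left`: hence `A⁻ k_R ≤ 1 ≤ A⁺ k_L`.
* `adjacent_ratio_window`: for `k_L ≤ k ≤ k_R`, `p (k+1) ≤ C p k` and `p k ≤ C p (k+1)` with
  the WALK CONSTANT `C = A⁺ k_L / A⁻ k_R ≥ 1`.
* `adjacent_ratio_window_sector`: the same in the exact shape of the walk hypothesis `hadj` of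
  `SectorTwistRatio.norm_ttSectorZ_twist_sub_le` (window `N - K_w ≤ k < k + 1 ≤ min (N + K_w) n`,
  rate `Real.exp (Real.log C)`), given `|m - N| ≤ K₀`, `K₀ + 2K + 2 ≤ K_w ≤ N`, `N + K_w ≤ n`.

No numerics, no `native_decide`; standard axioms only. References: folklore (Chebyshev /
second-moment method); programme notes bounds.tex §13.
-/

noncomputable section

namespace Summit.HubbardSuperconductivity.HubbardLadder.Bounds

open Finset Real

variable {w : ℕ → ℝ} {n : ℕ}

/-! ### Monotone runs -/

/-- A run `p i ≤ p (i+1)` for `i ≤ t` makes `p` non-decreasing on `[0, t + 1]`. [folklore] -/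
theorem le_of_monotone_run {p : ℕ → ℝ} {t : ℕ} (h : ∀ i ≤ t, p i ≤ p (i + 1)) {i j : ℕ}
    (hij : i ≤ j) (hj : j ≤ t + 1) : p i ≤ p j := by
  obtain ⟨d, rfl⟩ := Nat.exists_eq_add_of_le hij
  induction d with
  | zero => simp
  | succ d ih =>
    exact (ih (Nat.le_add_right i d) (by omega)).trans (h (i + d) (by omega))

/-- A run `p (i+1) ≤ p i` for `t ≤ i < u` makes `p` non-increasing on `[t, u]`. [folklore] -/
theorem le_of_antitone_run {p : ℕ → ℝ} {t u : ℕ} (h : ∀ i, t ≤ i → i + 1 ≤ u → p (i + 1) ≤ p i)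
    {i j : ℕ} (hi : t ≤ i) (hij : i ≤ j) (hj : j ≤ u) : p j ≤ p i := by
  obtain ⟨d, rfl⟩ := Nat.exists_eq_add_of_le hij
  induction d with
  | zero => simp
  | succ d ih =>
    exact (h (i + d) (by omega) (by omega)).trans (ih (Nat.le_add_right i d) (by omega))

/-! ### Chebyshev concentration on the window -/

/-- Under `Var(s) ≤ K²/4` the window `|k - m(s)| ≤ K` carries at least `3/4` of the tilted mass:
`3 Z(s) / 4 ≤ Σ_{|k - m| ≤ K} e^{sk} w k`. [folklore: Chebyshev] -/
theorem three_quarters_le_sum_filter_window (hw : ∀ k ≤ n, 0 < w k) (s : ℝ) {K : ℝ} (hK : 0 < K)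
    (hV : gcVar w n s ≤ K ^ 2 / 4) :
    3 * gcSum w n s / 4 ≤
      ∑ k ∈ (range (n + 1)).filter (fun k => |((k : ℕ) : ℝ) - gcMean w n s| ≤ K),
        exp (s * k) * w k := by
  have hZ := gcSum_pos hw s
  have htail := sum_filter_window_compl_le hw s hK
  have hsplit := sum_filter_add_sum_filter_not (range (n + 1))
    (fun k => |((k : ℕ) : ℝ) - gcMean w n s| ≤ K) (fun k => exp (s * k) * w k)
  have hq : gcVar w n s * gcSum w n s / K ^ 2 ≤ gcSum w n s / 4 := by
    rw [div_le_iff₀ (by positivity : (0 : ℝ) < K ^ 2)]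
    have h := mul_le_mul_of_nonneg_right hV hZ.le
    nlinarith [h]
  unfold gcSum at hsplit hq hZ htail ⊢
  linarith

/-- Under `Var(s) ≤ K²/4` the complement of the window carries at most `1/4` of the tilted mass.
[folklore: Chebyshev] -/
theorem sum_filter_window_compl_le_quarter (hw : ∀ k ≤ n, 0 < w k) (s : ℝ) {K : ℝ} (hK : 0 < K)
    (hV : gcVar w n s ≤ K ^ 2 / 4) :
    ∑ k ∈ (range (n + 1)).filter (fun k => ¬ |((k : ℕ) : ℝ) - gcMean w n s| ≤ K),
        exp (s * k) * w k ≤ gcSum w n s / 4 := by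
  have hZ := gcSum_pos hw s
  refine (sum_filter_window_compl_le hw s hK).trans ?_
  rw [div_le_iff₀ (by positivity : (0 : ℝ) < K ^ 2)]
  have h := mul_le_mul_of_nonneg_right hV hZ.le
  nlinarith [h]

/-! ### Monotone run versus concentration -/

/-- The averaging step: if every term of the window `I` is dominated by every term of a finset
`J`, then `|J| · Σ_I p ≤ |I| · Σ_J p`. [folklore] -/
theorem card_mul_sum_le_card_mul_sum {I J : Finset ℕ} {p : ℕ → ℝ}
    (h : ∀ j ∈ J, ∀ k ∈ I, p k ≤ p j) :
    (J.card : ℝ) * ∑ k ∈ I, p k ≤ (I.card : ℝ) * ∑ j ∈ J, p j := by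
  calc (J.card : ℝ) * ∑ k ∈ I, p k = ∑ k ∈ I, (J.card : ℝ) * p k := by rw [mul_sum]
    _ ≤ ∑ k ∈ I, ∑ j ∈ J, p j := by
        refine sum_le_sum fun k hk => ?_
        have h1 := card_nsmul_le_sum J (fun j => p j) (p k) (fun j hj => h j hj k hk)
        rwa [nsmul_eq_mul] at h1
    _ = (I.card : ℝ) * ∑ j ∈ J, p j := by rw [sum_const, nsmul_eq_mul]

/-- RIGHT RUN EXCLUDED. If `Var(s) ≤ K²/4`, `m(s) + 2K + 1 ≤ k_R` and `k_R + 1 ≤ n`, the tilted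
weights `p k = e^{sk} w k` are NOT non-decreasing on `[0, k_R + 1]`: the `≥ K + 2` indices in
`(m + K, k_R + 1]` would each carry at least the maximum of the window `|k - m| ≤ K` (`≤ 2K + 1`
points, mass `≥ 3Z/4`) while their total mass is `≤ Z/4`. [folklore; bounds.tex Lemma 13.5] -/
theorem not_monotone_run_right (hw : ∀ k ≤ n, 0 < w k) (s : ℝ) {K : ℝ} (hK : 0 < K)
    (hV : gcVar w n s ≤ K ^ 2 / 4) {kR : ℕ} (hkR : gcMean w n s + 2 * K + 1 ≤ kR)
    (hkRn : kR + 1 ≤ n) :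
    ¬ ∀ i ≤ kR, exp (s * i) * w i ≤ exp (s * ((i + 1 : ℕ) : ℝ)) * w (i + 1) := by
  intro hrun
  set m := gcMean w n s with hm
  have hZ := gcSum_pos hw s
  have hm0 : 0 ≤ m := gcMean_nonneg hw s
  set I := (range (n + 1)).filter (fun k => |((k : ℕ) : ℝ) - m| ≤ K) with hI
  set J := (range (n + 1)).filter (fun j => m + K < ((j : ℕ) : ℝ) ∧ j ≤ kR + 1) with hJ
  have hin : 3 * gcSum w n s / 4 ≤ ∑ k ∈ I, exp (s * k) * w k :=
    three_quarters_le_sum_filter_window hw s hK hV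
  have hIcard : (I.card : ℝ) ≤ 2 * K + 1 := card_range_filter_near_mean_le n m hK.le
  have hJsub : J ⊆ (range (n + 1)).filter (fun k => ¬ |((k : ℕ) : ℝ) - m| ≤ K) := by
    intro j hj
    rw [mem_filter] at hj ⊢
    refine ⟨hj.1, fun habs => ?_⟩
    linarith [(abs_le.1 habs).2, hj.2.1]
  have hJtail : ∑ j ∈ J, exp (s * j) * w j ≤ gcSum w n s / 4 :=
    (sum_le_sum_of_subset_of_nonneg hJsub fun k hk _ =>
      (mul_pos (exp_pos _) (hw k (Nat.lt_succ_iff.1 (mem_range.1 (mem_filter.1 hk).1)))).le).trans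
      (sum_filter_window_compl_le_quarter hw s hK hV)
  have hfl : (⌊m + K⌋₊ : ℝ) ≤ m + K := Nat.floor_le (by linarith)
  have hJcard : K + 1 ≤ (J.card : ℝ) := by
    have hsub : Icc (⌊m + K⌋₊ + 1) (kR + 1) ⊆ J := by
      intro j hj
      rw [mem_Icc] at hj
      rw [hJ, mem_filter, mem_range]
      refine ⟨by omega, ?_, hj.2⟩
      have h1 : ((⌊m + K⌋₊ + 1 : ℕ) : ℝ) ≤ j := by exact_mod_cast hj.1
      push_cast at h1
      linarith [Nat.lt_floor_add_one (m + K)]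
    have hc := card_le_card hsub
    rw [Nat.card_Icc] at hc
    have hle : ⌊m + K⌋₊ + 1 ≤ kR + 1 + 1 := by
      have : (⌊m + K⌋₊ : ℝ) ≤ kR := by linarith
      have h2 : ⌊m + K⌋₊ ≤ kR := by exact_mod_cast this
      omega
    have hc' : ((kR + 1 + 1 - (⌊m + K⌋₊ + 1) : ℕ) : ℝ) ≤ J.card := by exact_mod_cast hc
    rw [Nat.cast_sub hle] at hc'
    push_cast at hc'
    linarith
  have hdom : ∀ j ∈ J, ∀ k ∈ I, exp (s * k) * w k ≤ exp (s * j) * w j := by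
    intro j hj k hk
    have hk' := (abs_le.1 (mem_filter.1 hk).2).2
    have hj' := (mem_filter.1 hj).2
    have hkj : k ≤ j := by
      have : ((k : ℕ) : ℝ) ≤ j := by linarith
      exact_mod_cast this
    exact le_of_monotone_run (p := fun i : ℕ => exp (s * (i : ℝ)) * w i) hrun hkj hj'.2
  have hcomp := card_mul_sum_le_card_mul_sum hdom
  have hInonneg : 0 ≤ ∑ j ∈ J, exp (s * j) * w j :=
    sum_nonneg fun k hk =>
      (mul_pos (exp_pos _) (hw k (Nat.lt_succ_iff.1 (mem_range.1 (mem_filter.1 hk).1)))).le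
  have h1 : (K + 1) * (3 * gcSum w n s / 4) ≤ (J.card : ℝ) * ∑ k ∈ I, exp (s * k) * w k :=
    mul_le_mul hJcard hin (by positivity) (Nat.cast_nonneg _)
  have h2 : (I.card : ℝ) * ∑ j ∈ J, exp (s * j) * w j ≤ (2 * K + 1) * (gcSum w n s / 4) :=
    mul_le_mul hIcard hJtail hInonneg (by linarith)
  nlinarith [mul_pos hK hZ]

/-- LEFT RUN EXCLUDED. If `Var(s) ≤ K²/4` and `k_L + 2K + 1 ≤ m(s)`, the tilted weights are NOT
non-increasing on `[k_L, n]` (mirror image of `not_monotone_run_right`).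
[folklore; bounds.tex Lemma 13.5] -/
theorem not_antitone_run_left (hw : ∀ k ≤ n, 0 < w k) (s : ℝ) {K : ℝ} (hK : 0 < K)
    (hV : gcVar w n s ≤ K ^ 2 / 4) {kL : ℕ} (hkL : (kL : ℝ) + 2 * K + 1 ≤ gcMean w n s) :
    ¬ ∀ i, kL ≤ i → i + 1 ≤ n →
      exp (s * ((i + 1 : ℕ) : ℝ)) * w (i + 1) ≤ exp (s * i) * w i := by
  intro hrun
  set m := gcMean w n s with hm
  have hZ := gcSum_pos hw s
  have hmn : m ≤ n := gcMean_le hw s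
  set I := (range (n + 1)).filter (fun k => |((k : ℕ) : ℝ) - m| ≤ K) with hI
  set J := (range (n + 1)).filter (fun j => kL ≤ j ∧ ((j : ℕ) : ℝ) < m - K) with hJ
  have hin : 3 * gcSum w n s / 4 ≤ ∑ k ∈ I, exp (s * k) * w k :=
    three_quarters_le_sum_filter_window hw s hK hV
  have hIcard : (I.card : ℝ) ≤ 2 * K + 1 := card_range_filter_near_mean_le n m hK.le
  have hJsub : J ⊆ (range (n + 1)).filter (fun k => ¬ |((k : ℕ) : ℝ) - m| ≤ K) := by
    intro j hj
    rw [mem_filter] at hj ⊢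
    refine ⟨hj.1, fun habs => ?_⟩
    linarith [(abs_le.1 habs).1, hj.2.2]
  have hJtail : ∑ j ∈ J, exp (s * j) * w j ≤ gcSum w n s / 4 :=
    (sum_le_sum_of_subset_of_nonneg hJsub fun k hk _ =>
      (mul_pos (exp_pos _) (hw k (Nat.lt_succ_iff.1 (mem_range.1 (mem_filter.1 hk).1)))).le).trans
      (sum_filter_window_compl_le_quarter hw s hK hV)
  have hmK : 0 ≤ m - K := by linarith [(Nat.cast_nonneg kL : (0 : ℝ) ≤ kL)]
  have hce : m - K ≤ (⌈m - K⌉₊ : ℝ) := Nat.le_ceil _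
  have hce1 : (⌈m - K⌉₊ : ℝ) < m - K + 1 := Nat.ceil_lt_add_one hmK
  have hc1 : 1 ≤ ⌈m - K⌉₊ := by
    have : (0 : ℝ) < ⌈m - K⌉₊ := by linarith [(Nat.cast_nonneg kL : (0 : ℝ) ≤ kL)]
    exact_mod_cast this
  have hJcard : K + 1 ≤ (J.card : ℝ) := by
    have hsub : Icc kL (⌈m - K⌉₊ - 1) ⊆ J := by
      intro j hj
      rw [mem_Icc] at hj
      rw [hJ, mem_filter, mem_range]
      have h1 : ((j : ℕ) : ℝ) ≤ ((⌈m - K⌉₊ - 1 : ℕ) : ℝ) := by exact_mod_cast hj.2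
      rw [Nat.cast_sub hc1] at h1
      push_cast at h1
      refine ⟨?_, hj.1, by linarith⟩
      have : ((j : ℕ) : ℝ) < n + 1 := by linarith
      exact_mod_cast this
    have hc := card_le_card hsub
    rw [Nat.card_Icc] at hc
    have hle : kL ≤ ⌈m - K⌉₊ - 1 + 1 := by
      have : (kL : ℝ) ≤ ⌈m - K⌉₊ := by linarith
      have h2 : kL ≤ ⌈m - K⌉₊ := by exact_mod_cast this
      omega
    have hc' : ((⌈m - K⌉₊ - 1 + 1 - kL : ℕ) : ℝ) ≤ J.card := by exact_mod_cast hc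
    rw [Nat.cast_sub hle, Nat.sub_add_cancel hc1] at hc'
    linarith
  have hdom : ∀ j ∈ J, ∀ k ∈ I, exp (s * k) * w k ≤ exp (s * j) * w j := by
    intro j hj k hk
    have hk' := (abs_le.1 (mem_filter.1 hk).2).1
    have hkn : k ≤ n := Nat.lt_succ_iff.1 (mem_range.1 (mem_filter.1 hk).1)
    have hj' := (mem_filter.1 hj).2
    have hjk : j ≤ k := by
      have : ((j : ℕ) : ℝ) ≤ k := by linarith
      exact_mod_cast this
    exact le_of_antitone_run (p := fun i : ℕ => exp (s * (i : ℝ)) * w i) hrun hj'.1 hjk hkn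
  have hcomp := card_mul_sum_le_card_mul_sum hdom
  have hInonneg : 0 ≤ ∑ j ∈ J, exp (s * j) * w j :=
    sum_nonneg fun k hk =>
      (mul_pos (exp_pos _) (hw k (Nat.lt_succ_iff.1 (mem_range.1 (mem_filter.1 hk).1)))).le
  have h1 : (K + 1) * (3 * gcSum w n s / 4) ≤ (J.card : ℝ) * ∑ k ∈ I, exp (s * k) * w k :=
    mul_le_mul hJcard hin (by positivity) (Nat.cast_nonneg _)
  have h2 : (I.card : ℝ) * ∑ j ∈ J, exp (s * j) * w j ≤ (2 * K + 1) * (gcSum w n s / 4) :=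
    mul_le_mul hIcard hJtail hInonneg (by linarith)
  nlinarith [mul_pos hK hZ]

/-! ### The ratio envelope pins the walk constant -/

/-- RIGHT PIN. Under the lower ratio envelope `A⁻ k · p k ≤ p (k+1)` (`k + 1 ≤ n`) with `A⁻`
antitone, `Var(s) ≤ K²/4`, `m(s) + 2K + 1 ≤ k_R`, `k_R + 1 ≤ n`: `A⁻ k_R ≤ 1` (else the weights
would increase on `[0, k_R + 1]`). [folklore; bounds.tex Lemma 13.5] -/
theorem envelope_right_le_one (hw : ∀ k ≤ n, 0 < w k) (s : ℝ) {K : ℝ} (hK : 0 < K)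
    (hV : gcVar w n s ≤ K ^ 2 / 4) {Am : ℕ → ℝ} (hAm : ∀ i j : ℕ, i ≤ j → Am j ≤ Am i)
    (henv : ∀ k : ℕ, k + 1 ≤ n →
      Am k * (exp (s * k) * w k) ≤ exp (s * ((k + 1 : ℕ) : ℝ)) * w (k + 1))
    {kR : ℕ} (hkR : gcMean w n s + 2 * K + 1 ≤ kR) (hkRn : kR + 1 ≤ n) : Am kR ≤ 1 := by
  by_contra hcon
  have hcon' := not_le.1 hcon
  refine not_monotone_run_right hw s hK hV hkR hkRn fun i hi => ?_
  have hp : 0 ≤ exp (s * i) * w i := (mul_pos (exp_pos _) (hw i (by omega))).le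
  have h3 := henv i (by omega)
  nlinarith [mul_le_mul_of_nonneg_right (hAm i kR hi) hp]

/-- LEFT PIN. Under the upper ratio envelope `p (k+1) ≤ A⁺ k · p k` (`k_L ≤ k`, `k + 1 ≤ n`) with
`A⁺` antitone, `Var(s) ≤ K²/4` and `k_L + 2K + 1 ≤ m(s)`: `1 ≤ A⁺ k_L` (else the weights would
decrease on `[k_L, n]`). [folklore; bounds.tex Lemma 13.5] -/
theorem one_le_envelope_left (hw : ∀ k ≤ n, 0 < w k) (s : ℝ) {K : ℝ} (hK : 0 < K)
    (hV : gcVar w n s ≤ K ^ 2 / 4) {Ap : ℕ → ℝ} (hAp : ∀ i j : ℕ, i ≤ j → Ap j ≤ Ap i) {kL : ℕ}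
    (henv : ∀ k : ℕ, kL ≤ k → k + 1 ≤ n →
      exp (s * ((k + 1 : ℕ) : ℝ)) * w (k + 1) ≤ Ap k * (exp (s * k) * w k))
    (hkL : (kL : ℝ) + 2 * K + 1 ≤ gcMean w n s) : 1 ≤ Ap kL := by
  by_contra hcon
  have hcon' := not_le.1 hcon
  refine not_antitone_run_left hw s hK hV hkL fun i hi hin => ?_
  have hp : 0 ≤ exp (s * i) * w i := (mul_pos (exp_pos _) (hw i (by omega))).le
  have h3 := henv i hi hin
  nlinarith [mul_le_mul_of_nonneg_right (hAp kL i hi) hp]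

/-- The WALK CONSTANT `C = A⁺ k_L / A⁻ k_R` of the window `[k_L, k_R]`.
[programme definition: bounds.tex §13, Lemma 13.5] -/
def walkConstant (Am Ap : ℕ → ℝ) (kL kR : ℕ) : ℝ := Ap kL / Am kR

/-- ADJACENT-RATIO WINDOW (the walk input, abstract form). Under the ratio envelope
`A⁻ k · p k ≤ p (k+1)` (`k + 1 ≤ n`), `p (k+1) ≤ A⁺ k · p k` (`k_L ≤ k`, `k + 1 ≤ n`) with `A⁻ > 0`
and `A⁺` antitone, the Chebyshev input `Var(s) ≤ K²/4`, and `k_L + 2K + 1 ≤ m(s)`,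
`m(s) + 2K + 1 ≤ k_R`, `k_R + 1 ≤ n`: `1 ≤ C = A⁺ k_L / A⁻ k_R`, and for every `k_L ≤ k ≤ k_R`,
`p (k+1) ≤ C p k` and `p k ≤ C p (k+1)`. [folklore second-moment method; bounds.tex Lemma 13.5] -/
theorem adjacent_ratio_window (hw : ∀ k ≤ n, 0 < w k) (s : ℝ) {K : ℝ} (hK : 0 < K)
    (hV : gcVar w n s ≤ K ^ 2 / 4) {Am Ap : ℕ → ℝ} (hA : ∀ k : ℕ, 0 < Am k)
    (hAm : ∀ i j : ℕ, i ≤ j → Am j ≤ Am i) (hAp : ∀ i j : ℕ, i ≤ j → Ap j ≤ Ap i) {kL kR : ℕ}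
    (henvlo : ∀ k : ℕ, k + 1 ≤ n →
      Am k * (exp (s * k) * w k) ≤ exp (s * ((k + 1 : ℕ) : ℝ)) * w (k + 1))
    (henvhi : ∀ k : ℕ, kL ≤ k → k + 1 ≤ n →
      exp (s * ((k + 1 : ℕ) : ℝ)) * w (k + 1) ≤ Ap k * (exp (s * k) * w k))
    (hkL : (kL : ℝ) + 2 * K + 1 ≤ gcMean w n s)
    (hkR : gcMean w n s + 2 * K + 1 ≤ kR) (hkRn : kR + 1 ≤ n) :
    1 ≤ walkConstant Am Ap kL kR ∧
      ∀ k : ℕ, kL ≤ k → k ≤ kR →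
        exp (s * ((k + 1 : ℕ) : ℝ)) * w (k + 1) ≤
            walkConstant Am Ap kL kR * (exp (s * k) * w k) ∧
          exp (s * k) * w k ≤
            walkConstant Am Ap kL kR * (exp (s * ((k + 1 : ℕ) : ℝ)) * w (k + 1)) := by
  have hR := envelope_right_le_one hw s hK hV hAm henvlo hkR hkRn
  have hLe := one_le_envelope_left hw s hK hV hAp henvhi hkL
  have hAkR : 0 < Am kR := hA kR
  unfold walkConstant
  refine ⟨?_, fun k hkLk hkkR => ?_⟩
  · rw [le_div_iff₀ hAkR]
    linarith
  have hk1 : k + 1 ≤ n := by omega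
  have hlo := henvlo k hk1
  have hhi := henvhi k hkLk hk1
  have hp : 0 ≤ exp (s * k) * w k := (mul_pos (exp_pos _) (hw k (by omega))).le
  have hp1 : 0 ≤ exp (s * ((k + 1 : ℕ) : ℝ)) * w (k + 1) :=
    (mul_pos (exp_pos _) (hw (k + 1) hk1)).le
  have hAL : Ap k ≤ Ap kL := hAp kL k hkLk
  have hAR : Am kR ≤ Am k := hAm k kR hkkR
  constructor
  · calc exp (s * ((k + 1 : ℕ) : ℝ)) * w (k + 1) ≤ Ap kL * (exp (s * k) * w k) :=
          hhi.trans (mul_le_mul_of_nonneg_right hAL hp)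
      _ ≤ Ap kL / Am kR * (exp (s * k) * w k) := by
          refine mul_le_mul_of_nonneg_right ?_ hp
          rw [le_div_iff₀ hAkR]
          nlinarith
  · have hq : exp (s * k) * w k ≤ exp (s * ((k + 1 : ℕ) : ℝ)) * w (k + 1) / Am kR := by
      rw [le_div_iff₀ hAkR]
      calc exp (s * k) * w k * Am kR ≤ exp (s * k) * w k * Am k :=
            mul_le_mul_of_nonneg_left hAR hp
        _ ≤ exp (s * ((k + 1 : ℕ) : ℝ)) * w (k + 1) := by linarith
    refine hq.trans ?_
    rw [div_eq_mul_inv, mul_comm, div_eq_mul_inv]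
    refine mul_le_mul_of_nonneg_right ?_ hp1
    rw [le_mul_iff_one_le_left (inv_pos.2 hAkR)]
    exact hLe

/-! ### The sector form of the walk input -/

/-- SECTOR FORM (exactly the walk hypotheses `hG`, `hadj` of `norm_ttSectorZ_twist_sub_le`, with
the rate `G = log C`). Given `|m(s) - N| ≤ K₀`, a natural half-width `K_w` with
`K₀ + 2K + 2 ≤ K_w ≤ N` and `N + K_w ≤ n` (room below and above the sector), the ratio envelope
(`A⁻` on `k + 1 ≤ n`, `A⁺` on `N - K_w ≤ k`, `k + 1 ≤ n`) and `Var(s) ≤ K²/4`: for `N - K_w ≤ k`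
and `k + 1 ≤ min (N + K_w) n`, `e^{s(k+1)} w (k+1) ≤ e^{G} e^{sk} w k` and
`e^{sk} w k ≤ e^{G} e^{s(k+1)} w (k+1)` with `G = log (A⁺ (N - K_w) / A⁻ (N + K_w - 1)) ≥ 0`.
[folklore second-moment method; bounds.tex Lemma 13.5] -/
theorem adjacent_ratio_window_sector (hw : ∀ k ≤ n, 0 < w k) (s : ℝ) {K K₀ : ℝ} (hK : 0 < K)
    (hV : gcVar w n s ≤ K ^ 2 / 4) {Am Ap : ℕ → ℝ} (hA : ∀ k : ℕ, 0 < Am k)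
    (hAm : ∀ i j : ℕ, i ≤ j → Am j ≤ Am i) (hAp : ∀ i j : ℕ, i ≤ j → Ap j ≤ Ap i) {N Kw : ℕ}
    (henvlo : ∀ k : ℕ, k + 1 ≤ n →
      Am k * (exp (s * k) * w k) ≤ exp (s * ((k + 1 : ℕ) : ℝ)) * w (k + 1))
    (henvhi : ∀ k : ℕ, N - Kw ≤ k → k + 1 ≤ n →
      exp (s * ((k + 1 : ℕ) : ℝ)) * w (k + 1) ≤ Ap k * (exp (s * k) * w k))
    (hm : |gcMean w n s - N| ≤ K₀) (hKw : K₀ + 2 * K + 2 ≤ Kw) (hKwN : Kw ≤ N)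
    (hNn : N + Kw ≤ n) :
    0 ≤ Real.log (walkConstant Am Ap (N - Kw) (N + Kw - 1)) ∧
      ∀ k : ℕ, N - Kw ≤ k → k + 1 ≤ min (N + Kw) n →
        Real.exp (s * (k + 1 : ℕ)) * w (k + 1) ≤
            Real.exp (Real.log (walkConstant Am Ap (N - Kw) (N + Kw - 1))) *
              (Real.exp (s * k) * w k) ∧
          Real.exp (s * k) * w k ≤
            Real.exp (Real.log (walkConstant Am Ap (N - Kw) (N + Kw - 1))) *
              (Real.exp (s * (k + 1 : ℕ)) * w (k + 1)) := by
  have hmN := abs_le.1 hm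
  have hkL : (((N - Kw : ℕ) : ℝ)) + 2 * K + 1 ≤ gcMean w n s := by
    rw [Nat.cast_sub hKwN]; linarith
  have hKw1 : 1 ≤ Kw := by
    have : (1 : ℝ) ≤ Kw := by linarith [(abs_nonneg _ : (0 : ℝ) ≤ _).trans hm]
    exact_mod_cast this
  have hkR : gcMean w n s + 2 * K + 1 ≤ ((N + Kw - 1 : ℕ) : ℝ) := by
    rw [Nat.cast_sub (by omega)]; push_cast; linarith
  have hkRn : N + Kw - 1 + 1 ≤ n := by omega
  obtain ⟨hC1, hwin⟩ :=
    adjacent_ratio_window hw s hK hV hA hAm hAp henvlo henvhi hkL hkR hkRn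
  have hCpos : 0 < walkConstant Am Ap (N - Kw) (N + Kw - 1) := by linarith
  refine ⟨Real.log_nonneg hC1, fun k hk hk1 => ?_⟩
  rw [Real.exp_log hCpos]
  have hk1' : k ≤ N + Kw - 1 := by
    have := le_min_iff.1 hk1
    omega
  exact hwin k hk hk1'

end Summit.HubbardSuperconductivity.HubbardLadder.Bounds
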